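import Mathlib.Analysis.InnerProductSpace.PiL2
import Mathlib.Geometry.Manifold.ContMDiff.Atlas
import Mathlib.Geometry.Manifold.Immersion
import Mathlib.Geometry.Manifold.SmoothEmbedding
import Mathlib.Geometry.Manifold.Instances.Real
import HarnessLib

/-!
# Slice charts: the smooth structure on a codimension-one slice subset

Topic `Literature/Topology/FourManifolds` (infrastructure for regular level sets of Morse
functions on cobordisms, `RegularLevelSet.lean`; rung v1 of the DAG of the fact item
`provefact-Literature.nonempty_homeomorph_of_isHCobordant_four`, shared with rung K2 of
`provefact-Literature.corkDecomposition`, see `HCobordismMiddleLevel.lean`).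

Let `M` be a `C^∞` manifold modelled on a model with corners `I` on the vector space `ℝⁿ⁺¹`
(`EuclideanSpace ℝ (Fin (n + 1))`; e.g. `𝓡 (n + 1)` or the half-space model `𝓡∂ (n + 1)` of
manifolds with boundary) and let `S ⊆ M`. A *family of slice charts* for `S`
(`Literature.SliceChartFamily I S`) assigns to every `p ∈ S` a chart `ψₚ` of the maximal `C^∞` atlas
of `M` around `p`, valued in the interior of the model, in which `S` is the slice
`{last coordinate = 0}`:  `q ∈ S ↔ (I (ψₚ q))ₙ = 0` for `q` in the domain of `ψₚ`. This is the
hypothesis of the standard "slice lemma": *if every point of `S` lies in such a chart then `S`,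
with the subspace topology and the charts `πₙ ∘ ψₚ|S` (drop the last coordinate), is a smooth
`n`-manifold (without boundary) and the inclusion `S ↪ M` is a smooth embedding* — Lee,
*Introduction to Smooth Manifolds* (2013), Thm. 5.8 (embedded submanifolds are exactly the
subsets satisfying the local `k`-slice condition) with Thm. 5.11/Problem 5-2 for the charts,
here in codimension one and at interior points. Regular level sets of smooth real functions
(Lee, Cor. 5.14; Milnor, *Lectures on the h-cobordism theorem* (1965), §3, the levels `f⁻¹(c)`
of a Morse function on a cobordism) are the application in `RegularLevelSet.lean`, where the
slice charts are produced by the inverse function theorem.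

## Contents

* `Literature.snocEquiv n : (ℝⁿ × ℝ) ≃L[ℝ] ℝⁿ⁺¹`, `(u, t) ↦ (u₀, …, uₙ₋₁, t)` (`Fin.snoc` on
  `EuclideanSpace`), the splitting of the model vector space used throughout: the *last*
  coordinate is the slice coordinate (the first one is reserved by `𝓡∂ (n + 1)` for the
  boundary-defining half-space `{0 ≤ x 0}`).
* `OpenPartialHomeomorph.conjModel I G`: an open partial homeomorphism `G` of the model vector
  space `E`, conjugated by the model with corners `I : H → E` to an open partial homeomorphism of
  the model space `H`, on the part of the interior of `range I` that `G` keeps inside the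
  interior; `conjModel_mem_contDiffGroupoid`: it lies in `contDiffGroupoid n I` when `G` and
  `G.symm` are `Cⁿ`; `StructureGroupoid.trans_mem_maximalAtlas`: post-composing a chart of the
  maximal atlas with a groupoid element stays in the maximal atlas. (This is how new compatible
  charts at interior points are manufactured from diffeomorphisms of `E`.)
* `Literature.SliceChartFamily I S` and, for `Ψ : SliceChartFamily I S`: the charts
  `Ψ.levelChart p : OpenPartialHomeomorph S (𝔼 n)`, the charted-space structure
  `Ψ.chartedSpace : ChartedSpace (𝔼 n) S` and `Ψ.isManifold : IsManifold (𝓡 n) ∞ S` (as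
  `def`s — the structure depends on the choice `Ψ`; consumers register them as instances on a
  type synonym, cf. `Literature.Topology.FourManifolds.RegularLevel`), and under these instances
  `Ψ.isImmersion_subtype_val`, `Ψ.isSmoothEmbedding_subtype_val`: the inclusion `S → M` is a
  smooth embedding (in the charts `Ψ.levelChart p`, `Ψ.chart p` it reads `u ↦ snocEquiv n (u, 0)`,
  Mathlib's normal form `Manifold.IsImmersionAtOfComplement` with complement `ℝ`).

The construction mirrors `Literature.BoundaryManifold` (`Cobordism.lean`: the boundary `∂W` from the
boundary charts, where *every* chart is a slice chart and the slice is `{x 0 = 0}`).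

## Design notes

* `OpenPartialHomeomorph.conjModel` (with its lemmas) and `StructureGroupoid.trans_mem_maximalAtlas`
  are general-purpose and stated in Mathlib's generality (any field `𝕜`, any model with corners,
  any structure groupoid); they are deliberately declared in Mathlib's namespaces
  `OpenPartialHomeomorph` and `StructureGroupoid` as dot-notation extensions. Everything else is
  in `namespace Literature`.
* The charted-space structure `Ψ.chartedSpace` on `↥S` depends on the data `Ψ`, so it is a
  (reducible) `def`, and the theorems about it (`Ψ.isManifold`, `Ψ.isImmersion_subtype_val`, …)
  bind it with `letI := Ψ.chartedSpace` in their statements; a consumer registers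
  `Ψ.chartedSpace`/`Ψ.isManifold` as instances on a type synonym (as `Literature.Topology.FourManifolds.RegularLevel` does) and
  then uses these theorems directly (the instances agree definitionally).
* Only `C^∞` is treated (the tree's manifolds are `C^∞`), and only codimension one with the
  complement `ℝ` split off as the *last* coordinate of `ℝⁿ⁺¹` (`snocEquiv`).

## References

* J. M. Lee, *Introduction to Smooth Manifolds*, 2nd ed., GTM 218, Springer (2013), Ch. 5:
  Thm. 5.8 (Local Slice Criterion for Embedded Submanifolds, p. 101, with the atlas
  `(x¹, …, xᵏ)` built from slice coordinates in its proof, p. 102), Thm. 5.11 and Problem 5-2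
  (the boundary), Cor. 5.14 (Regular Level Set Theorem, p. 106). [LeeSmoothManifolds2013]
* M. W. Hirsch, *Differential Topology*, GTM 33, Springer (1976), Ch. 1, §2, p. 14 (submanifold
  charts: `φ(U ∩ A) = φ(U) ∩ ℝᵏ`, `ℝᵏ` = vectors whose last `n - k` coordinates vanish; "the
  maps `φ|U ∩ A` form a `Cʳ` atlas for `A`") and §3, Thm. 3.1 (a submanifold, with this
  structure, is the image of the embedding given by its inclusion). [HirschDT1976]
* J. Milnor, *Lectures on the h-cobordism theorem*, Princeton Univ. Press (1965), §3.
  [MilnorHCobordism1965]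
-/

open scoped Manifold ContDiff Topology
open Set Function

noncomputable section

universe u

/-! ### Conjugating a partial homeomorphism of the model vector space into the model space -/

namespace OpenPartialHomeomorph

section ConjModel

variable {𝕜 : Type*} [NontriviallyNormedField 𝕜] {E : Type*} [NormedAddCommGroup E]
  [NormedSpace 𝕜 E] {H : Type*} [TopologicalSpace H] (I : ModelWithCorners 𝕜 E H)
  (G : OpenPartialHomeomorph E E)

/-- The open partial homeomorphism `I⁻¹ ∘ G ∘ I` of the model space `H` obtained from an open
partial homeomorphism `G` of the model vector space `E` by conjugating with the model with corners
`I : H → E`; its source is the set of `x` with `I x` in the interior of `range I`, in the source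
of `G`, and with `G (I x)` again in the interior of `range I` (so for a boundaryless model this
is just `G` read in `H ≃ E`). Used to turn local diffeomorphisms of `E` into compatible charts at
interior points. [folklore] -/
def conjModel : OpenPartialHomeomorph H H where
  toFun x := I.symm (G (I x))
  invFun x := I.symm (G.symm (I x))
  source := I ⁻¹' (interior (range I) ∩ (G.source ∩ G ⁻¹' interior (range I)))
  target := I ⁻¹' (interior (range I) ∩ (G.target ∩ G.symm ⁻¹' interior (range I)))
  map_source' x hx := by
    simp only [mem_preimage, mem_inter_iff] at hx ⊢
    obtain ⟨hx₁, hx₂, hx₃⟩ := hx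
    rw [I.right_inv (interior_subset hx₃)]
    exact ⟨hx₃, G.map_source hx₂, by rw [G.left_inv hx₂]; exact hx₁⟩
  map_target' x hx := by
    simp only [mem_preimage, mem_inter_iff] at hx ⊢
    obtain ⟨hx₁, hx₂, hx₃⟩ := hx
    rw [I.right_inv (interior_subset hx₃)]
    exact ⟨hx₃, G.map_target hx₂, by rw [G.right_inv hx₂]; exact hx₁⟩
  left_inv' x hx := by
    simp only [mem_preimage, mem_inter_iff] at hx
    obtain ⟨-, hx₂, hx₃⟩ := hx
    rw [I.right_inv (interior_subset hx₃), G.left_inv hx₂, I.left_inv]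
  right_inv' x hx := by
    simp only [mem_preimage, mem_inter_iff] at hx
    obtain ⟨-, hx₂, hx₃⟩ := hx
    rw [I.right_inv (interior_subset hx₃), G.right_inv hx₂, I.left_inv]
  open_source :=
    (isOpen_interior.inter (G.continuousOn.isOpen_inter_preimage G.open_source
      isOpen_interior)).preimage I.continuous
  open_target :=
    (isOpen_interior.inter (G.continuousOn_symm.isOpen_inter_preimage G.open_target
      isOpen_interior)).preimage I.continuous
  continuousOn_toFun :=
    I.continuous_symm.comp_continuousOn
      (G.continuousOn.comp I.continuous.continuousOn fun _ hx => hx.2.1)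
  continuousOn_invFun :=
    I.continuous_symm.comp_continuousOn
      (G.continuousOn_symm.comp I.continuous.continuousOn fun _ hx => hx.2.1)

/-- `conjModel` as a function (definitional). [folklore] -/
@[simp]
theorem conjModel_apply (x : H) : G.conjModel I x = I.symm (G (I x)) := rfl

/-- The inverse of `conjModel` as a function (definitional). [folklore] -/
@[simp]
theorem conjModel_symm_apply (x : H) : (G.conjModel I).symm x = I.symm (G.symm (I x)) := rfl

/-- The source of `conjModel` (definitional). [folklore] -/
theorem conjModel_source : (G.conjModel I).source =
    I ⁻¹' (interior (range I) ∩ (G.source ∩ G ⁻¹' interior (range I))) := rfl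

/-- The target of `conjModel` (definitional). [folklore] -/
theorem conjModel_target : (G.conjModel I).target =
    I ⁻¹' (interior (range I) ∩ (G.target ∩ G.symm ⁻¹' interior (range I))) := rfl

variable {I G} in
/-- Membership in the source of `conjModel`, unfolded. [folklore] -/
theorem mem_conjModel_source {x : H} : x ∈ (G.conjModel I).source ↔
    I x ∈ interior (range I) ∧ I x ∈ G.source ∧ G (I x) ∈ interior (range I) :=
  Iff.rfl

variable {I G} in
/-- On its source, `conjModel I G` read in `E` is `G`. [folklore] -/
theorem apply_conjModel_of_mem_source {x : H} (hx : x ∈ (G.conjModel I).source) :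
    I (G.conjModel I x) = G (I x) :=
  I.right_inv (interior_subset hx.2.2)

variable {I G} in
/-- **`conjModel` of a `Cⁿ` diffeomorphism is a `Cⁿ` change of coordinates**: if `G` and
`G.symm` are `Cⁿ` on their domains then `conjModel I G ∈ contDiffGroupoid n I` (read back in
`E` through `I`, the map and its inverse are `G` and `G.symm`). [folklore] -/
theorem conjModel_mem_contDiffGroupoid {n : WithTop ℕ∞} (hG : ContDiffOn 𝕜 n G G.source)
    (hG' : ContDiffOn 𝕜 n G.symm G.target) : G.conjModel I ∈ contDiffGroupoid n I := by
  rw [contDiffGroupoid, mem_groupoid_of_pregroupoid]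
  constructor
  · refine (hG.mono ?_).congr ?_
    · rintro y ⟨hy, hy'⟩
      rw [mem_preimage, mem_conjModel_source, I.right_inv hy'] at hy
      exact hy.2.1
    · rintro y ⟨hy, hy'⟩
      rw [mem_preimage, mem_conjModel_source, I.right_inv hy'] at hy
      simp only [comp_apply, conjModel_apply]
      rw [I.right_inv hy', I.right_inv (interior_subset hy.2.2)]
  · refine (hG'.mono ?_).congr ?_
    · rintro y ⟨hy, hy'⟩
      simp only [mem_preimage, conjModel_target, mem_inter_iff, I.right_inv hy'] at hy
      exact hy.2.1
    · rintro y ⟨hy, hy'⟩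
      simp only [mem_preimage, conjModel_target, mem_inter_iff, I.right_inv hy'] at hy
      simp only [comp_apply, conjModel_symm_apply]
      rw [I.right_inv hy', I.right_inv (interior_subset hy.2.2)]

end ConjModel

end OpenPartialHomeomorph

/-- **Post-composing with a groupoid element stays in the maximal atlas**: if `e` is a chart of
the maximal atlas of `M` for the structure groupoid `G₀` and `K ∈ G₀`, then `e ≫ₕ K` is again in
the maximal atlas (compatibility with an atlas chart `e'` is `K⁻¹ ≫ (e⁻¹ ≫ e')` and
`(e'⁻¹ ≫ e) ≫ K`, both in `G₀`). No `HasGroupoid M G₀` hypothesis is needed (as for Mathlib's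
`StructureGroupoid.compatible_of_mem_maximalAtlas`): membership of `e` in the maximal atlas
already provides both compatibilities with every atlas chart. [folklore] -/
theorem StructureGroupoid.trans_mem_maximalAtlas {H : Type*} [TopologicalSpace H] {M : Type*}
    [TopologicalSpace M] [ChartedSpace H M] (G₀ : StructureGroupoid H)
    {e : OpenPartialHomeomorph M H} {K : OpenPartialHomeomorph H H}
    (he : e ∈ G₀.maximalAtlas M) (hK : K ∈ G₀) : e ≫ₕ K ∈ G₀.maximalAtlas M := by
  rw [mem_maximalAtlas_iff]
  intro e' he'
  obtain ⟨h₁, h₂⟩ := (mem_maximalAtlas_iff.1 he) e' he'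
  constructor
  · rw [OpenPartialHomeomorph.trans_symm_eq_symm_trans_symm, OpenPartialHomeomorph.trans_assoc]
    exact G₀.trans (G₀.symm hK) h₁
  · rw [← OpenPartialHomeomorph.trans_assoc]
    exact G₀.trans h₂ hK

namespace Literature.Topology.FourManifolds

/-- Local notation: `𝔼 n` is the model Euclidean space `EuclideanSpace ℝ (Fin n)`. -/
local notation "𝔼 " n:arg => EuclideanSpace ℝ (Fin n)

/-! ### `ℝⁿ × ℝ ≅ ℝⁿ⁺¹`, the last coordinate split off -/

section Snoc

variable (n : ℕ)

/-- The linear isomorphism `ℝⁿ × ℝ ≅ ℝⁿ⁺¹`, `(u, t) ↦ (u₀, …, uₙ₋₁, t)` (`Fin.snoc` transported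
to `EuclideanSpace`). [folklore] -/
def snocLinearEquiv : (𝔼 n × ℝ) ≃ₗ[ℝ] 𝔼 (n + 1) where
  toFun p := WithLp.toLp 2 (Fin.snoc (fun i => p.1 i) p.2)
  invFun y := (WithLp.toLp 2 fun i => y (Fin.castSucc i), y (Fin.last n))
  map_add' p q := by
    ext i
    refine Fin.lastCases ?_ (fun j => ?_) i <;> simp
  map_smul' c p := by
    ext i
    refine Fin.lastCases ?_ (fun j => ?_) i <;> simp
  left_inv p := by
    obtain ⟨u, t⟩ := p
    ext i <;> simp
  right_inv y := by
    ext i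
    refine Fin.lastCases ?_ (fun j => ?_) i <;> simp

/-- The continuous linear isomorphism `ℝⁿ × ℝ ≅ ℝⁿ⁺¹`, `(u, t) ↦ (u₀, …, uₙ₋₁, t)`: the last
coordinate of `ℝⁿ⁺¹` is split off (the first one is the coordinate defining the half-space
`EuclideanHalfSpace (n + 1) = {x | 0 ≤ x 0}` of the model `𝓡∂ (n + 1)`). [folklore] -/
def snocEquiv : (𝔼 n × ℝ) ≃L[ℝ] 𝔼 (n + 1) :=
  (snocLinearEquiv n).toContinuousLinearEquiv

/-- The first `n` coordinates of `snocEquiv n (u, t)` are those of `u`. [folklore] -/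
@[simp]
theorem snocEquiv_apply_castSucc (p : 𝔼 n × ℝ) (i : Fin n) :
    snocEquiv n p (Fin.castSucc i) = p.1 i := by
  simp [snocEquiv, snocLinearEquiv]

/-- The last coordinate of `snocEquiv n (u, t)` is `t`. [folklore] -/
@[simp]
theorem snocEquiv_apply_last (p : 𝔼 n × ℝ) : snocEquiv n p (Fin.last n) = p.2 := by
  simp [snocEquiv, snocLinearEquiv]

/-- The `ℝⁿ`-component of `(snocEquiv n).symm y` consists of the first `n` coordinates of `y`.
[folklore] -/
@[simp]
theorem snocEquiv_symm_apply_fst (y : 𝔼 (n + 1)) (i : Fin n) :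
    ((snocEquiv n).symm y).1 i = y (Fin.castSucc i) := by
  simp [snocEquiv, snocLinearEquiv]

/-- The `ℝ`-component of `(snocEquiv n).symm y` is the last coordinate of `y`. [folklore] -/
@[simp]
theorem snocEquiv_symm_apply_snd (y : 𝔼 (n + 1)) : ((snocEquiv n).symm y).2 = y (Fin.last n) := by
  simp [snocEquiv, snocLinearEquiv]

/-- For `n ≥ 1`, the `0`-th coordinate of `snocEquiv n (u, t)` is `u 0`. [folklore] -/
theorem snocEquiv_apply_zero [NeZero n] (p : 𝔼 n × ℝ) : snocEquiv n p 0 = p.1 0 := by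
  rw [← Fin.castSucc_zero, snocEquiv_apply_castSucc]

/-- A vector with vanishing last coordinate is recovered from its first `n` coordinates.
[folklore] -/
theorem snocEquiv_fst_zero_of_apply_last {y : 𝔼 (n + 1)} (hy : y (Fin.last n) = 0) :
    snocEquiv n (((snocEquiv n).symm y).1, 0) = y := by
  conv_rhs => rw [← (snocEquiv n).apply_symm_apply y]
  congr 1
  exact Prod.ext rfl (by rw [snocEquiv_symm_apply_snd, hy])

/-- The first `n` coordinates of `snocEquiv n (u, t)` form `u`. [folklore] -/
@[simp]
theorem snocEquiv_symm_apply_fst_snocEquiv (u : 𝔼 n) (t : ℝ) :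
    ((snocEquiv n).symm (snocEquiv n (u, t))).1 = u := by
  rw [ContinuousLinearEquiv.symm_apply_apply]

/-- `u ↦ snocEquiv n (u, 0)` is continuous. [folklore] -/
theorem continuous_snocEquiv_zero : Continuous fun u : 𝔼 n => snocEquiv n (u, 0) :=
  (snocEquiv n).continuous.comp (continuous_id.prodMk continuous_const)

/-- `u ↦ snocEquiv n (u, 0)` is smooth. [folklore] -/
theorem contDiff_snocEquiv_zero : ContDiff ℝ ∞ fun u : 𝔼 n => snocEquiv n (u, 0) :=
  (snocEquiv n).contDiff.comp (contDiff_id.prodMk contDiff_const)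

/-- `y ↦ ((snocEquiv n).symm y).1` is smooth. [folklore] -/
theorem contDiff_snocEquiv_symm_fst : ContDiff ℝ ∞ fun y : 𝔼 (n + 1) => ((snocEquiv n).symm y).1 :=
  contDiff_fst.comp (snocEquiv n).symm.contDiff

end Snoc

/-! ### Families of slice charts and the manifold structure on the slice -/

section Slice

variable {n : ℕ} {H : Type*} [TopologicalSpace H] (I : ModelWithCorners ℝ (𝔼 (n + 1)) H)
  {M : Type u} [TopologicalSpace M] [ChartedSpace H M]

/-- A *family of slice charts* for a subset `S` of a `C^∞` manifold `M` modelled on a model with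
corners `I` on `ℝⁿ⁺¹`: for every `p ∈ S` a chart `chart p` of the maximal `C^∞` atlas of `M`
with `p` in its source, valued in the interior of the model (`I (chart p q) ∈ interior (range I)`
on the source), in which `S` is the slice `{last coordinate = 0}`:
`q ∈ S ↔ I (chart p q) (Fin.last n) = 0` for `q` in the source. This is the hypothesis of the
local slice criterion for embedded submanifolds, in codimension one and at interior points
(Lee, *Introduction to Smooth Manifolds* (2013), Thm. 5.8, "local `k`-slice condition" with
`k = n`; Hirsch, *Differential Topology* (1976), Ch. 1, §2, p. 14, "submanifold charts", with
the slice the vanishing of the *last* coordinates as here).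
[cite: LeeSmoothManifolds2013, Thm. 5.8] [cite: HirschDT1976, Ch. 1 §2, p. 14] -/
structure SliceChartFamily (S : Set M) where
  /-- The slice chart of `M` at `p ∈ S`. -/
  chart : S → OpenPartialHomeomorph M H
  /-- Slice charts are compatible with the smooth structure of `M`. -/
  mem_maximalAtlas : ∀ p, chart p ∈ IsManifold.maximalAtlas I ∞ M
  /-- `p` lies in the source of its slice chart. -/
  mem_source : ∀ p, p.1 ∈ (chart p).source
  /-- In a slice chart, `S` is the slice `{last coordinate = 0}`. -/
  mem_iff : ∀ p, ∀ q ∈ (chart p).source, q ∈ S ↔ I (chart p q) (Fin.last n) = 0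
  /-- Slice charts take values in the interior of the model. -/
  mem_interior : ∀ p, ∀ q ∈ (chart p).source, I (chart p q) ∈ interior (range I)

namespace SliceChartFamily

variable {I} {S : Set M} (Ψ : SliceChartFamily I S)

/-- On `S`, a slice chart is determined by its first `n` coordinates. [folklore] -/
theorem snocEquiv_fst_chart (p : S) {q : M} (hq : q ∈ (Ψ.chart p).source) (hqS : q ∈ S) :
    snocEquiv n (((snocEquiv n).symm (I (Ψ.chart p q))).1, 0) = I (Ψ.chart p q) :=
  snocEquiv_fst_zero_of_apply_last n ((Ψ.mem_iff p q hq).1 hqS)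

/-- A slice chart pulls the slice `{last coordinate = 0}` (within the interior of the model and
the target) back into `S`. [folklore] -/
theorem symm_mem (p : S) {u : 𝔼 n} (hu : snocEquiv n (u, 0) ∈ interior (range I))
    (hu' : I.symm (snocEquiv n (u, 0)) ∈ (Ψ.chart p).target) :
    (Ψ.chart p).symm (I.symm (snocEquiv n (u, 0))) ∈ S := by
  rw [Ψ.mem_iff p _ ((Ψ.chart p).map_target hu'), (Ψ.chart p).right_inv hu',
    I.right_inv (interior_subset hu), snocEquiv_apply_last]

open Classical in
/-- The chart of `S` at `p ∈ S` induced by the slice chart `Ψ.chart p`: restrict to `S` and drop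
the last coordinate (which vanishes on `S`); the inverse is `u ↦ (Ψ.chart p)⁻¹ (I⁻¹ (u, 0))` on
the target (and the junk value `p` elsewhere). Lee, *Introduction to Smooth Manifolds* (2013),
proof of Thm. 5.8. [cite: LeeSmoothManifolds2013, Thm. 5.8] -/
def levelChart (p : S) : OpenPartialHomeomorph S (𝔼 n) where
  source := Subtype.val ⁻¹' (Ψ.chart p).source
  target := {u | snocEquiv n (u, 0) ∈ interior (range I) ∧
    I.symm (snocEquiv n (u, 0)) ∈ (Ψ.chart p).target}
  toFun q := ((snocEquiv n).symm (I (Ψ.chart p q.1))).1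
  invFun u :=
    if h : snocEquiv n (u, 0) ∈ interior (range I) ∧
        I.symm (snocEquiv n (u, 0)) ∈ (Ψ.chart p).target then
      ⟨(Ψ.chart p).symm (I.symm (snocEquiv n (u, 0))), Ψ.symm_mem p h.1 h.2⟩
    else p
  map_source' q hq := by
    simp only [mem_preimage] at hq
    refine ⟨?_, ?_⟩ <;> rw [Ψ.snocEquiv_fst_chart p hq q.2]
    · exact Ψ.mem_interior p _ hq
    · rw [I.left_inv]; exact (Ψ.chart p).map_source hq
  map_target' u hu := by
    have hu' : snocEquiv n (u, 0) ∈ interior (range I) ∧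
        I.symm (snocEquiv n (u, 0)) ∈ (Ψ.chart p).target := hu
    simp only [hu', and_self, ↓reduceDIte, mem_preimage]
    exact (Ψ.chart p).map_target hu'.2
  left_inv' q hq := by
    simp only [mem_preimage] at hq
    have h1 := Ψ.snocEquiv_fst_chart p hq q.2
    have h2 : snocEquiv n (((snocEquiv n).symm (I (Ψ.chart p q.1))).1, 0) ∈ interior (range I) ∧
        I.symm (snocEquiv n (((snocEquiv n).symm (I (Ψ.chart p q.1))).1, 0)) ∈
          (Ψ.chart p).target := by
      rw [h1, I.left_inv]
      exact ⟨Ψ.mem_interior p _ hq, (Ψ.chart p).map_source hq⟩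
    simp only [h2, and_self, ↓reduceDIte]
    ext1
    simp only [h1]
    rw [I.left_inv, (Ψ.chart p).left_inv hq]
  right_inv' u hu := by
    have hu' : snocEquiv n (u, 0) ∈ interior (range I) ∧
        I.symm (snocEquiv n (u, 0)) ∈ (Ψ.chart p).target := hu
    simp only [hu', and_self, ↓reduceDIte]
    rw [(Ψ.chart p).right_inv hu'.2, I.right_inv (interior_subset hu'.1),
      snocEquiv_symm_apply_fst_snocEquiv]
  open_source := (Ψ.chart p).open_source.preimage continuous_subtype_val
  open_target :=
    (isOpen_interior.preimage (continuous_snocEquiv_zero n)).inter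
      ((Ψ.chart p).open_target.preimage (I.continuous_symm.comp (continuous_snocEquiv_zero n)))
  continuousOn_toFun := by
    refine (contDiff_snocEquiv_symm_fst n).continuous.comp_continuousOn
      (I.continuous.comp_continuousOn ?_)
    exact (Ψ.chart p).continuousOn.comp continuous_subtype_val.continuousOn fun q hq => hq
  continuousOn_invFun := by
    rw [Topology.IsInducing.subtypeVal.continuousOn_iff]
    refine ContinuousOn.congr
      (f := fun u => (Ψ.chart p).symm (I.symm (snocEquiv n (u, 0)))) ?_ ?_
    · exact (Ψ.chart p).continuousOn_symm.comp
        (I.continuous_symm.comp (continuous_snocEquiv_zero n)).continuousOn fun u hu => hu.2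
    · intro u hu
      have hu' : snocEquiv n (u, 0) ∈ interior (range I) ∧
          I.symm (snocEquiv n (u, 0)) ∈ (Ψ.chart p).target := hu
      simp [hu']

/-- `Ψ.levelChart p` is "drop the last coordinate of `I ∘ Ψ.chart p`" (definitional).
[folklore] -/
@[simp]
theorem levelChart_apply (p q : S) :
    Ψ.levelChart p q = ((snocEquiv n).symm (I (Ψ.chart p q.1))).1 := rfl

/-- The source of `Ψ.levelChart p` is `S ∩ (Ψ.chart p).source` (definitional). [folklore] -/
@[simp]
theorem levelChart_source (p : S) :
    (Ψ.levelChart p).source = Subtype.val ⁻¹' (Ψ.chart p).source := rfl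

/-- The target of `Ψ.levelChart p` (definitional). [folklore] -/
theorem mem_levelChart_target {p : S} {u : 𝔼 n} : u ∈ (Ψ.levelChart p).target ↔
    snocEquiv n (u, 0) ∈ interior (range I) ∧
      I.symm (snocEquiv n (u, 0)) ∈ (Ψ.chart p).target :=
  Iff.rfl

/-- On its target, the inverse of `Ψ.levelChart p` is `u ↦ (Ψ.chart p)⁻¹ (I⁻¹ (u, 0))`.
[folklore] -/
theorem coe_levelChart_symm_of_mem {p : S} {u : 𝔼 n} (hu : u ∈ (Ψ.levelChart p).target) :
    ((Ψ.levelChart p).symm u).val = (Ψ.chart p).symm (I.symm (snocEquiv n (u, 0))) := by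
  have hu' : snocEquiv n (u, 0) ∈ interior (range I) ∧
      I.symm (snocEquiv n (u, 0)) ∈ (Ψ.chart p).target := hu
  have : (Ψ.levelChart p).symm u = ⟨_, Ψ.symm_mem p hu'.1 hu'.2⟩ := dif_pos hu'
  rw [this]

/-- On `S`, the slice chart is recovered from the level chart: `I (Ψ.chart p q) =
snocEquiv n (Ψ.levelChart p q, 0)`. [folklore] -/
theorem snocEquiv_levelChart {p q : S} (hq : q ∈ (Ψ.levelChart p).source) :
    snocEquiv n (Ψ.levelChart p q, 0) = I (Ψ.chart p q.1) :=
  Ψ.snocEquiv_fst_chart p hq q.2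

/-- **The smooth structure on a slice subset, charts.** The atlas of `S` induced by a family of
slice charts `Ψ` consists of the level charts `Ψ.levelChart p`, `p ∈ S`. A `def`, not an
instance: it depends on `Ψ`. Lee, *Introduction to Smooth Manifolds* (2013), Thm. 5.8.
[cite: LeeSmoothManifolds2013, Thm. 5.8] -/
@[reducible]
def chartedSpace : ChartedSpace (𝔼 n) S where
  atlas := range Ψ.levelChart
  chartAt := Ψ.levelChart
  mem_chart_source p := Ψ.mem_source p
  chart_mem_atlas p := mem_range_self p

/-- The atlas of `Ψ.chartedSpace` is the range of `Ψ.levelChart` (definitional). [folklore] -/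
theorem atlas_eq : letI := Ψ.chartedSpace; atlas (H := 𝔼 n) (M := S) = range Ψ.levelChart := rfl

/-- The preferred chart of `Ψ.chartedSpace` at `p` is `Ψ.levelChart p` (definitional).
[folklore] -/
theorem chartAt_eq (p : S) : letI := Ψ.chartedSpace; chartAt (H := 𝔼 n) p = Ψ.levelChart p :=
  rfl

/-- **The smooth structure on a slice subset, compatibility.** The level charts of a family of
slice charts form a `C^∞` atlas: the transition map from `Ψ.levelChart p` to `Ψ.levelChart p'`
is `u ↦ πₙ (τ (u, 0))` for the (extended) transition map `τ` of `M` between the slice charts,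
which is smooth because slice charts lie in the maximal atlas. (Statement and proof under the
charted-space structure `Ψ.chartedSpace`, bound by `letI`.) Lee, *Introduction to Smooth
Manifolds* (2013), Thm. 5.8. [cite: LeeSmoothManifolds2013, Thm. 5.8] -/
theorem isManifold : letI := Ψ.chartedSpace; IsManifold (𝓡 n) ∞ S := by
  letI := Ψ.chartedSpace
  apply isManifold_of_contDiffOn
  rintro e e' ⟨p, rfl⟩ ⟨p', rfl⟩
  have key : ContDiffOn ℝ ∞
      (fun u : 𝔼 n => ((snocEquiv n).symm
        (I.extendCoordChange (Ψ.chart p) (Ψ.chart p') (snocEquiv n (u, 0)))).1)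
      ((Ψ.levelChart p).target ∩ (Ψ.levelChart p).symm ⁻¹' (Ψ.levelChart p').source) := by
    refine (contDiff_snocEquiv_symm_fst n).comp_contDiffOn (ContDiffOn.comp
      (I.contDiffOn_extendCoordChange (Ψ.mem_maximalAtlas p) (Ψ.mem_maximalAtlas p'))
      (contDiff_snocEquiv_zero n).contDiffOn ?_)
    rintro u ⟨hu1, hu2⟩
    rw [ModelWithCorners.extendCoordChange_source]
    refine ⟨I.symm (snocEquiv n (u, 0)), ⟨hu1.2, ?_⟩, I.right_inv (interior_subset hu1.1)⟩
    simp only [mem_preimage, levelChart_source] at hu2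
    rwa [Ψ.coe_levelChart_symm_of_mem hu1] at hu2
  simp only [modelWithCornersSelf_coe, modelWithCornersSelf_coe_symm, preimage_id, range_id,
    inter_univ, Function.comp_id, Function.id_comp]
  rw [OpenPartialHomeomorph.coe_trans, OpenPartialHomeomorph.trans_source,
    OpenPartialHomeomorph.symm_source]
  refine key.congr ?_
  rintro u ⟨hu1, hu2⟩
  simp only [comp_apply, levelChart_apply, PartialEquiv.coe_trans,
    OpenPartialHomeomorph.extend_coe, OpenPartialHomeomorph.extend_coe_symm,
    Ψ.coe_levelChart_symm_of_mem hu1]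

/-- **The inclusion of a slice subset is a smooth immersion**: in the charts `Ψ.levelChart p`
and `Ψ.chart p` the inclusion `S → M` reads `u ↦ snocEquiv n (u, 0)`, Mathlib's normal form
`Manifold.IsImmersionAtOfComplement` with complement `ℝ` (codimension one). Lee,
*Introduction to Smooth Manifolds* (2013), Thm. 5.8. [cite: LeeSmoothManifolds2013, Thm. 5.8] -/
theorem isImmersion_subtype_val [IsManifold I ∞ M] :
    letI := Ψ.chartedSpace; Manifold.IsImmersion (𝓡 n) I ∞ (Subtype.val : S → M) := by
  letI := Ψ.chartedSpace
  haveI := Ψ.isManifold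
  refine Manifold.IsImmersionOfComplement.isImmersion (F := ℝ) fun p => ?_
  refine Manifold.IsImmersionAtOfComplement.mk_of_continuousAt
    continuous_subtype_val.continuousAt (snocEquiv n) (Ψ.levelChart p) (Ψ.chart p)
    (Ψ.mem_source p) (Ψ.mem_source p) (IsManifold.chart_mem_maximalAtlas p)
    (Ψ.mem_maximalAtlas p) ?_
  intro u hu
  rw [OpenPartialHomeomorph.extend_target, modelWithCornersSelf_coe_symm, modelWithCornersSelf_coe,
    range_id, inter_univ, preimage_id] at hu
  have hu' : u ∈ (Ψ.levelChart p).target := hu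
  simp only [comp_apply, OpenPartialHomeomorph.extend_coe, OpenPartialHomeomorph.extend_coe_symm,
    modelWithCornersSelf_coe_symm, id_eq]
  rw [Ψ.coe_levelChart_symm_of_mem hu', (Ψ.chart p).right_inv hu'.2,
    I.right_inv (interior_subset hu'.1)]

/-- **The inclusion of a slice subset is a smooth embedding** (a smooth immersion and a
topological embedding). Lee, *Introduction to Smooth Manifolds* (2013), Thm. 5.8.
[cite: LeeSmoothManifolds2013, Thm. 5.8] -/
theorem isSmoothEmbedding_subtype_val [IsManifold I ∞ M] :
    letI := Ψ.chartedSpace; Manifold.IsSmoothEmbedding (𝓡 n) I ∞ (Subtype.val : S → M) := by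
  letI := Ψ.chartedSpace
  exact ⟨Ψ.isImmersion_subtype_val, Topology.IsEmbedding.subtypeVal⟩

/-- The inclusion of a slice subset is smooth. [cite: LeeSmoothManifolds2013, Thm. 5.8] -/
theorem contMDiff_subtype_val [IsManifold I ∞ M] :
    letI := Ψ.chartedSpace; ContMDiff (𝓡 n) I ∞ (Subtype.val : S → M) := by
  letI := Ψ.chartedSpace
  exact (Ψ.isImmersion_subtype_val).contMDiff

end SliceChartFamily

end Slice

end Literature.Topology.FourManifolds
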